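import Mathlib
import Summits.Ventures.DiscreteObjects.Mahler.CensusCertificate
import Summits.Ventures.DiscreteObjects.Mahler.Height1CellSymmetry

/-!
# Kernel census: the `x ↦ -x` symmetry halves the search (venture `DiscreteObjects`, target L)

Cell `pub-namedobj`, seat `pub-namedobj-mahler-g12`. Framing: lottery ticket; floor = certified bounds/negative
ranges.

`p ↦ p(-x)` preserves "monic palindromic of degree `2d`", irreducibility and the Mahler measure, and flips the sign
of `c₁ = [x^{2d-1}] p`. Hence certificates are only needed for the survivors of `censusSearch` with `c₁ ≥ 0`:
`census_verdict_nonneg`, `degreeCensus_of_certified_nonneg` (same conclusions as `census_verdict`,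
`degreeCensus_of_certified`). Used from degree 12 on, where the search has ≈ 5·10⁵ leaves. Also the generic
one-level unfolding `mem_censusSearch_succ_iff` (`nodeLo`, `nodeHi`) used to split chunks of the kernel check.
-/

namespace Summit.Ventures.DiscreteObjects.Mahler

open Polynomial

/-- `p(-x)` of a monic palindromic `p` of degree `2d ≥ 2` is monic palindromic of degree `2d`, with `c₁` negated. -/
theorem comp_neg_X_palindromic {p : ℤ[X]} {d : ℕ} (hd : 1 ≤ d) (hmonic : p.Monic) (hdeg : p.natDegree = 2 * d)
    (hpal : ∀ j ≤ 2 * d, p.coeff j = p.coeff (2 * d - j)) :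
    (p.comp (-X)).Monic ∧ (p.comp (-X)).natDegree = 2 * d ∧
      (∀ j ≤ 2 * d, (p.comp (-X)).coeff j = (p.comp (-X)).coeff (2 * d - j)) ∧
      (p.comp (-X)).coeff (2 * d - 1) = -p.coeff (2 * d - 1) := by
  -- `[xⁿ] p(-x) = (-1)ⁿ [xⁿ] p` (as in `Height1CellSymmetry.natAbs_coeff_comp_neg_X`)
  have coeff_comp_neg_X_int : ∀ (q : ℤ[X]) (n : ℕ), (q.comp (-X)).coeff n = (-1) ^ n * q.coeff n := by
    intro q n
    induction q using Polynomial.induction_on' with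
    | add p q hp hq => simp [add_comp, hp, hq, mul_add]
    | monomial k a =>
      rw [monomial_comp, coeff_monomial]
      have e : (C a * (-X) ^ k : ℤ[X]) = C (a * (-1) ^ k) * X ^ k := by
        rw [neg_pow, C_mul, C_pow, C_neg, C_1]; ring
      rw [e, coeff_C_mul_X_pow]
      by_cases hnk : n = k
      · subst hnk; simp; ring
      · simp [hnk, Ne.symm hnk]
  have hdeg' : (p.comp (-X)).natDegree = 2 * d := by
    rw [natDegree_comp, hdeg]; simp
  refine ⟨?_, hdeg', ?_, ?_⟩
  · rw [Monic, leadingCoeff, hdeg', coeff_comp_neg_X_int, ← hdeg, hmonic.coeff_natDegree, hdeg, pow_mul]; simp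
  · intro j hj
    rw [coeff_comp_neg_X_int, coeff_comp_neg_X_int, hpal j hj]
    congr 1
    have hb : ((-1 : ℤ) ^ j) * (-1) ^ j = 1 := by rw [← pow_add, ← two_mul, pow_mul, neg_one_sq, one_pow]
    have hab : (-1 : ℤ) ^ (2 * d - j) * (-1) ^ j = 1 := by
      rw [← pow_add, Nat.sub_add_cancel hj, pow_mul, neg_one_sq, one_pow]
    calc (-1 : ℤ) ^ j = ((-1) ^ (2 * d - j) * (-1) ^ j) * (-1) ^ j := by rw [hab, one_mul]
      _ = (-1) ^ (2 * d - j) * ((-1) ^ j * (-1) ^ j) := by ring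
      _ = (-1) ^ (2 * d - j) := by rw [hb, mul_one]
  · rw [coeff_comp_neg_X_int, Odd.neg_one_pow ⟨d - 1, by omega⟩]; ring

/-- The head of the half vector is `c₁ = [x^{2d-1}] p`. -/
theorem getD_zero_take_descCoeffList {p : ℤ[X]} {d : ℕ} (hd : 1 ≤ d) (hdeg : p.natDegree = 2 * d) :
    ((descCoeffList p).take d).getD 0 0 = p.coeff (2 * d - 1) := by
  rw [getD_take_of_lt _ (by omega), getD_descCoeffList, descCoeff, hdeg, if_pos (by omega)]

/-- Every output of `censusSearch T fuel pre` extends the prefix `pre`. -/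
theorem isPrefix_of_mem_censusSearch (T : List ℕ) :
    ∀ (fuel : ℕ) (pre a : List ℤ), a ∈ censusSearch T fuel pre → pre <+: a := by
  intro fuel
  induction fuel with
  | zero =>
    intro pre a h
    simp only [censusSearch] at h
    split_ifs at h
    · rw [List.mem_singleton] at h; rw [h]
    · simp at h
  | succ fuel ih =>
    intro pre a h
    rw [censusSearch, List.mem_flatMap] at h
    obtain ⟨ak, -, h⟩ := h
    exact (List.prefix_append pre [ak]).trans (ih _ _ h)

/-- In the chunk with first coefficient `a1`, every output starts with `a1`. -/
theorem getD_zero_of_mem_censusSearch_singleton {T : List ℕ} {fuel : ℕ} {a1 : ℤ} {a : List ℤ}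
    (h : a ∈ censusSearch T fuel [a1]) : a.getD 0 0 = a1 := by
  obtain ⟨t, ht⟩ := isPrefix_of_mem_censusSearch T fuel [a1] a h
  rw [← ht]; simp

/-- Lower end of the range of the next coefficient at the search node `pre`. -/
def nodeLo (T : List ℕ) (pre : List ℤ) : ℤ :=
  -((((T.getD pre.length 0 : ℕ) : ℤ) + (List.zipWith (· * ·) pre (psumsRev pre pre.length)).sum) /
      ((pre.length + 1 : ℕ) : ℤ))

/-- Upper end of the range of the next coefficient at the search node `pre`. -/
def nodeHi (T : List ℕ) (pre : List ℤ) : ℤ :=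
  (((T.getD pre.length 0 : ℕ) : ℤ) - (List.zipWith (· * ·) pre (psumsRev pre pre.length)).sum) /
    ((pre.length + 1 : ℕ) : ℤ)

/-- One level of the search, unfolded at an arbitrary node (used to split big chunks further). -/
theorem mem_censusSearch_succ_iff {T : List ℕ} {f : ℕ} {pre a : List ℤ} :
    a ∈ censusSearch T (f + 1) pre ↔ ∃ ak ∈ icc (nodeLo T pre) (nodeHi T pre), a ∈ censusSearch T f (pre ++ [ak]) := by
  rw [censusSearch, List.mem_flatMap]
  rfl

/-- At a node `a1 :: pre'`, every output starts with `a1`. -/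
theorem getD_zero_of_mem_censusSearch_cons {T : List ℕ} {fuel : ℕ} {a1 : ℤ} {pre' a : List ℤ}
    (h : a ∈ censusSearch T fuel (a1 :: pre')) : a.getD 0 0 = a1 := by
  obtain ⟨t, ht⟩ := isPrefix_of_mem_censusSearch T fuel (a1 :: pre') a h
  rw [← ht]; simp

/-- The second level of the search, unfolded: after `c₁ = a1` the coefficient `c₂` ranges over
`[-((T₂ - a1²) / 2), (T₂ + a1²) / 2]`. -/
theorem mem_censusSearch_succ_singleton_iff {T : List ℕ} {f : ℕ} {a1 : ℤ} {a : List ℤ} :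
    a ∈ censusSearch T (f + 1) [a1] ↔
      ∃ a2 ∈ icc (-((((T.getD 1 0 : ℕ) : ℤ) - a1 * a1) / 2)) ((((T.getD 1 0 : ℕ) : ℤ) + a1 * a1) / 2),
        a ∈ censusSearch T f [a1, a2] := by
  rw [censusSearch, List.mem_flatMap]
  have h1 : (List.zipWith (· * ·) [a1] (psumsRev [a1] 1)).sum = -(a1 * a1) := by
    simp [psumsRev, psumsStep, newtonNext]
  simp only [List.length_singleton, h1, List.singleton_append]
  rw [show ((1 + 1 : ℕ) : ℤ) = 2 by norm_num, ← sub_eq_add_neg, sub_neg_eq_add]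

/-- **Census verdict from certificates for `c₁ ≥ 0` only.** -/
theorem census_verdict_nonneg {Bn Bd d : ℕ} {T : List ℕ} {L : List (List ℤ)}
    (hBd : 0 < Bd) (hd : 1 ≤ d) (hdT : d ≤ T.length) (hT : ThresholdsValid d ((Bn : ℝ) / Bd) T)
    (hcert : ∀ a ∈ censusSearch T d [], 0 ≤ a.getD 0 0 → ∃ c, checkCert Bn Bd (2 * d) L (1 :: palC a) c = true)
    {p : ℤ[X]} (hmonic : p.Monic) (hdeg : p.natDegree = 2 * d)
    (hpal : ∀ j ≤ 2 * d, p.coeff j = p.coeff (2 * d - j)) (hirr : Irreducible p)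
    (h1 : 1 < intMahlerMeasure p) (hB : intMahlerMeasure p < (Bn : ℝ) / Bd) :
    ∃ l ∈ L, p = ofCoeffs l ∨ p = (ofCoeffs l).comp (-X) := by
  -- the case `c₁ ≥ 0`, for any such polynomial
  have key : ∀ q : ℤ[X], q.Monic → q.natDegree = 2 * d → (∀ j ≤ 2 * d, q.coeff j = q.coeff (2 * d - j)) →
      Irreducible q → 1 < intMahlerMeasure q → intMahlerMeasure q < (Bn : ℝ) / Bd → 0 ≤ q.coeff (2 * d - 1) →
      ∃ l ∈ L, q = ofCoeffs l ∨ q = (ofCoeffs l).comp (-X) := by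
    intro q hqm hqd hqp hqi hq1 hqB hq0
    have hmem := take_descCoeffList_mem_censusSearch hd hqm hqd hqp hqB hdT hT
    obtain ⟨c, hc⟩ := hcert _ hmem (by rw [getD_zero_take_descCoeffList hd hqd]; exact hq0)
    rw [palC_take_descCoeffList hd hqm hqd hqp] at hc
    have hp := eq_ofCoeffs_descCoeffList hqm hqd hqp
    have hmon' : (ofCoeffs (1 :: descCoeffList q)).Monic := by rw [← hp]; exact hqm
    have hdeg' : (ofCoeffs (1 :: descCoeffList q)).natDegree = 2 * d := by rw [← hp]; exact hqd
    have hs := checkCert_sound hBd hc hmon' hdeg'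
    rw [← hp] at hs
    rcases hs with h | h | h | h
    · rw [h] at hq1; exact absurd hq1 (lt_irrefl _)
    · exact absurd hqi h
    · exact absurd hqB (not_lt.mpr h.le)
    · exact h
  by_cases h0 : 0 ≤ p.coeff (2 * d - 1)
  · exact key p hmonic hdeg hpal hirr h1 hB h0
  · push Not at h0
    obtain ⟨hqm, hqd, hqp, hqc⟩ := comp_neg_X_palindromic hd hmonic hdeg hpal
    have hq := key (p.comp (-X)) hqm hqd hqp (irreducible_comp_neg_X hirr)
      (by rw [intMahlerMeasure_comp_neg_X]; exact h1) (by rw [intMahlerMeasure_comp_neg_X]; exact hB)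
      (by rw [hqc]; omega)
    obtain ⟨l, hl, h⟩ := hq
    refine ⟨l, hl, ?_⟩
    rcases h with h | h
    · right; rw [← h, comp_neg_X_comp_neg_X]
    · left
      have := congrArg (fun r : ℤ[X] => r.comp (-X)) h
      simpa only [comp_neg_X_comp_neg_X] using this

/-- **From the halved kernel check to a census row** (`B = Bn/Bd ≤ θ₀`). -/
theorem degreeCensus_of_certified_nonneg {Bn Bd d : ℕ} {T : List ℕ} {L : List (List ℤ)}
    (hBd : 0 < Bd) (hd : 1 ≤ d) (hdT : d ≤ T.length) (hT : ThresholdsValid d ((Bn : ℝ) / Bd) T)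
    (hθ : (Bn : ℝ) / Bd ≤ smythTheta)
    (hcert : ∀ a ∈ censusSearch T d [], 0 ≤ a.getD 0 0 → ∃ c, checkCert Bn Bd (2 * d) L (1 :: palC a) c = true) :
    DegreeCensus (2 * d) ((Bn : ℝ) / Bd) L := by
  intro p hdeg hirr h1 h2
  have hrev := (reciprocal_of_measure_lt_smythTheta hirr h1 (lt_of_lt_of_le h2 hθ)).1
  have hlc : (|p.leadingCoeff| : ℝ) ≤ intMahlerMeasure p := abs_leadingCoeff_le_intMahlerMeasure p
  have hθ2 : smythTheta < 2 := by have := smythTheta_lt; linarith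
  have hlc1 : p.leadingCoeff = 1 ∨ p.leadingCoeff = -1 := by
    have hne : p.leadingCoeff ≠ 0 := leadingCoeff_ne_zero.mpr hirr.ne_zero
    have hle : |p.leadingCoeff| ≤ 1 := by
      by_contra h
      push Not at h
      have : (2 : ℝ) ≤ (|p.leadingCoeff| : ℝ) := by
        have : (2 : ℤ) ≤ |p.leadingCoeff| := h
        exact_mod_cast this
      linarith
    rcases abs_le.mp hle with ⟨h1', h2'⟩
    omega
  obtain ⟨hmonic, hpm, hMm, hdegm, hirrm⟩ := monic_normalisation hlc1
  set q := C p.leadingCoeff * p with hq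
  have hrevq : q.reverse = q := by rw [hq, reverse_mul_of_domain, reverse_C, hrev]
  rw [hdeg] at hdegm
  have hpal := palindromic_of_reverse_eq_self q (2 * d) hdegm hrevq
  rw [← hMm] at h1 h2
  obtain ⟨l, hl, hql⟩ := census_verdict_nonneg hBd hd hdT hT hcert hmonic hdegm hpal (hirrm hirr) h1 h2
  refine ⟨l, hl, ?_⟩
  rcases hlc1 with hc | hc
  · have hpq : p = q := by rw [hpm, hc, C_1, one_mul]
    rcases hql with h | h
    · exact Or.inl (hpq.trans h)
    · exact Or.inr (Or.inr (Or.inl (hpq.trans h)))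
  · have hpq : p = -q := by
      conv_lhs => rw [hpm, hc]
      simp
    rcases hql with h | h
    · exact Or.inr (Or.inl (by rw [hpq, h]))
    · exact Or.inr (Or.inr (Or.inr (by rw [hpq, h])))

end Summit.Ventures.DiscreteObjects.Mahler
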